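import Summits.FinalStateConjecture.FinalStateConjecture.Theses.SignedCensus
import Literature.Geometry.Lorentzian.NonRotatingBlackHoleUniqueness
import Literature.Geometry.Lorentzian.StaticBlackHoleUniqueness
import Literature.Geometry.Lorentzian.LorentzianMetricProofs

/-!
# Route `SignedCensus`, item `StaticAnchor` — reduction to the two printed theorems

Support item `stmt-FinalStateConjecture-10827` (`Theses.SignedCensus.StaticAnchor`): level `0` of
the rotation-graded no-hair family — a regular (globally hyperbolic carrier, the slice a Cauchy
hypersurface) smooth stationary AF vacuum black hole with connected non-degenerate horizon on which
the stationary Killing field `T` is causal has d.o.c. isometric to a subextremal Kerr exterior.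

This file proves the item CONDITIONALLY, isolating exactly what separates the typed statement
from the literature.  The printed route (Chruściel–Costa–Heusler 2012, §3.3.1) is

  non-rotating `⇒` static (Sudarsky–Wald 1993 on the Chruściel–Wald maximal slice)
  `⇒` Schwarzschild (Chruściel–Costa 2008 Thm. 1.4 / Chruściel–Galloway 2010),

both vendored in the tree as the named facts `SudarskyWald1993_staticity` and
`ChruscielGalloway2010_docStaticUniqueness` (`Literature/Geometry/Lorentzian/NonRotatingBlackHoleUniqueness`),
and BOTH consume Chruściel–Costa's `I⁺`-regularity (`StationaryAFBlackHole.IsIPlusRegular`,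
CC08 Def. 1.1) together with the non-rotating clause ON `T` ITSELF (`T ≠ 0` on `𝓔⁺`,
`∇_T T = κ T`, `κ ≠ 0`).  The route's predicate instead offers global hyperbolicity of the whole
carrier, the Cauchy property of the slice, an EXISTENTIALLY quantified horizon Killing field `K`
(`IsNonDegenerateHorizon`) and causality of `T` on `𝓔⁺`.  Accordingly:

* `conclusion_of_isIsometricToSchwarzschildExterior` — the Literature conclusion
  `IsIsometricToSchwarzschildExterior` (at the tree's proved restriction fact
  `PseudoRiemannianMetric.contMDiff_restrict_holds`) implies the route's unfolded pointwise
  conclusion (`IsIsometry`, `pullbackBilin_apply` and `val_restrict` are definitional);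
* `conclusion_of_isIPlusRegular_of_killing` — for ONE black hole: `I⁺`-regular + vacuum + the
  `T`-witness of non-degeneracy `⇒` the route's conclusion, given the two named facts;
* `staticAnchor_of_bridge` — `StaticAnchor` itself, given the two named facts and the two halves
  of the REGULARITY BRIDGE: the route's hypotheses imply `IsIPlusRegular` (`hB1`) and the
  `T`-witness (`hB2`).  The bridge is spelled out as hypotheses (it is not a published theorem:
  Chruściel–Costa ASSUME (1.1), "we have not been able to develop a coherent theory without
  assuming some version of (1.1)").

References: D. Sudarsky, R. M. Wald, Phys. Rev. D 47 (1993) R5209, Thms. 1–2; P. T. Chruściel,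
J. L. Costa, Astérisque 321 (2008), arXiv:0806.0016, Def. 1.1, Thm. 1.4, §7.2; P. T. Chruściel,
G. J. Galloway, arXiv:1004.0513, Thm. 1.1; P. T. Chruściel, J. L. Costa, M. Heusler, Living Rev.
Relativity 15 (2012) 7, §3.3.1 and Thm. 3.1.
-/

noncomputable section

-- summit = problem name (D-0017)
set_option linter.dupNamespace false

namespace Summit.FinalStateConjecture.FinalStateConjecture.Theorems.SignedCensus.StaticAnchor

open Set Function Filter Literature.Geometry.Lorentzian
open scoped Manifold ContDiff Topology

/-- **From the Schwarzschild conclusion to the route's unfolded conclusion.**  If the d.o.c. of `𝓑`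
is isometric to a Schwarzschild exterior (`IsIsometricToSchwarzschildExterior`, stated at the
proved restriction fact `contMDiff_restrict_holds`), then there are subextremal Kerr parameters
`(M, a)` (namely `a = 0 < M`) and a `C^∞` diffeomorphism `Φ` of the d.o.c. onto `Kerr.exterior M a`
with `g_Kerr(dΦ v, dΦ w) = g(v, w)` pointwise — the conclusion of every decl of route
`SignedCensus`.  Chruściel–Costa–Heusler 2012, Thm. 3.1 (Schwarzschild is Kerr with `a = 0`);
the unfolding of `PseudoRiemannianMetric.IsIsometry` is definitional (O'Neill 1983, Def. 3.4). -/
theorem conclusion_of_isIsometricToSchwarzschildExterior (𝓑 : StationaryAFBlackHole.{0})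
    [Kerr.Facts]
    (hF : 𝓑.metric.isOpen_chronologicalFuture 𝓑.timeOrientation)
    (hP : 𝓑.metric.isOpen_chronologicalPast 𝓑.timeOrientation)
    (h : 𝓑.IsIsometricToSchwarzschildExterior hF hP
      PseudoRiemannianMetric.contMDiff_restrict_holds) :
    ∃ (M a : ℝ) (_ : Kerr.IsSubextremal M a)
      (Φ : Diffeomorph (𝓡 4) 𝓘(ℝ, E4) (𝓑.docOpens hF hP) (Kerr.exterior M a)
        ((⊤ : ℕ∞) : WithTop ℕ∞)),
      ∀ (y : 𝓑.docOpens hF hP) (v w : EuclideanSpace ℝ (Fin 4)),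
        (Kerr.smoothMetric M a (Kerr.rPlus M a)).val (Φ y)
            (mfderiv (𝓡 4) 𝓘(ℝ, E4) Φ y v) (mfderiv (𝓡 4) 𝓘(ℝ, E4) Φ y w) =
          𝓑.metric.val y.1 v w := by
  obtain ⟨M, a, hsub, Φ, hΦ⟩ := h.isIsometricToKerrExterior
  refine ⟨M, a, hsub, Φ, fun y v w ↦ ?_⟩
  have hy := hΦ y
  have hyvw := congrArg (fun B : TangentSpace (𝓡 4) y →L[ℝ] TangentSpace (𝓡 4) y →L[ℝ] ℝ ↦ B v w) hy
  simp only [pullbackBilin_apply] at hyvw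
  exact hyvw

/-- **The non-rotating endgame for one black hole (conditional on the two printed theorems).**
Let `𝓑` be an `I⁺`-regular (Chruściel–Costa 2008, Def. 1.1) vacuum stationary AF black hole with
non-empty future event horizon `𝓔⁺` on which the stationary Killing field `T` has no zeros and
satisfies `∇_T T = κ T` for one constant `κ ≠ 0` (non-rotating, non-degenerate).  Given the
Sudarsky–Wald staticity theorem (`SudarskyWald1993_staticity`: `T` is hypersurface-orthogonal on
`⟨⟨M_ext⟩⟩`) and static uniqueness for a static d.o.c. (`ChruscielGalloway2010_docStaticUniqueness`),
the d.o.c. is isometric to a subextremal Kerr exterior in the route's unfolded sense.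
Chruściel–Costa 2008, §7.2; Chruściel–Costa–Heusler 2012, §3.3.1 with Thm. 3.1. -/
theorem conclusion_of_isIPlusRegular_of_killing
    (hSW : SudarskyWald1993_staticity) (hCG : ChruscielGalloway2010_docStaticUniqueness)
    (𝓑 : StationaryAFBlackHole.{0}) [𝓑.metric.HasLeviCivita] [Kerr.Facts]
    (hF : 𝓑.metric.isOpen_chronologicalFuture 𝓑.timeOrientation)
    (hP : 𝓑.metric.isOpen_chronologicalPast 𝓑.timeOrientation)
    (hreg : 𝓑.IsIPlusRegular) (hvac : 𝓑.metric.toPseudoRiemannianMetric.IsRicciFlat)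
    (hne : 𝓑.horizon.Nonempty) (hT : ∀ p ∈ 𝓑.horizon, 𝓑.killing p ≠ 0)
    (hκ : ∃ κ : ℝ, κ ≠ 0 ∧ ∀ p ∈ 𝓑.horizon,
      𝓑.metric.leviCivita 𝓑.killing p (𝓑.killing p) = κ • 𝓑.killing p) :
    ∃ (M a : ℝ) (_ : Kerr.IsSubextremal M a)
      (Φ : Diffeomorph (𝓡 4) 𝓘(ℝ, E4) (𝓑.docOpens hF hP) (Kerr.exterior M a)
        ((⊤ : ℕ∞) : WithTop ℕ∞)),
      ∀ (y : 𝓑.docOpens hF hP) (v w : EuclideanSpace ℝ (Fin 4)),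
        (Kerr.smoothMetric M a (Kerr.rPlus M a)).val (Φ y)
            (mfderiv (𝓡 4) 𝓘(ℝ, E4) Φ y v) (mfderiv (𝓡 4) 𝓘(ℝ, E4) Φ y w) =
          𝓑.metric.val y.1 v w := by
  have hstat : 𝓑.metric.toPseudoRiemannianMetric.IsHypersurfaceOrthogonalOn 𝓑.killing 𝓑.doc :=
    hSW 𝓑 hreg hvac hne hT hκ
  exact conclusion_of_isIsometricToSchwarzschildExterior 𝓑 hF hP
    (hCG 𝓑 hF hP PseudoRiemannianMetric.contMDiff_restrict_holds hreg hstat hvac hne)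

/-- **`StaticAnchor` modulo the regularity bridge and the two printed theorems.**  The route's
level-`0` statement `Theses.SignedCensus.StaticAnchor` follows from
(i) the Sudarsky–Wald staticity theorem `SudarskyWald1993_staticity`,
(ii) static vacuum uniqueness for a static d.o.c. `ChruscielGalloway2010_docStaticUniqueness`, and
the two halves of the REGULARITY BRIDGE between the route's typed predicate (globally hyperbolic
carrier, the embedded slice a Cauchy hypersurface, connected non-degenerate `𝓔⁺` with the horizon
Killing field quantified existentially, `T` normalised at infinity and causal on `𝓔⁺`, vacuum) and
the printed hypotheses:
(iii) `hB1` — such a black hole is `I⁺`-regular in the sense of Chruściel–Costa 2008, Def. 1.1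
(`StationaryAFBlackHole.IsIPlusRegular`);
(iv) `hB2` — for such a black hole the non-degeneracy witness may be taken to be `T` itself
(`T ≠ 0` on `𝓔⁺` and `∇_T T = κ T` there for one constant `κ ≠ 0`: a non-rotating horizon).
Clauses (iii)–(iv) are exactly what the typed predicate leaves unproved relative to the printed
theorems; they are hypotheses here, not assertions (Chruściel–Costa ASSUME their (1.1)).
Chruściel–Costa–Heusler 2012, §3.3.1; Chruściel–Costa 2008, Def. 1.1 and §7.2. -/
theorem staticAnchor_of_bridge
    (hSW : SudarskyWald1993_staticity) (hCG : ChruscielGalloway2010_docStaticUniqueness)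
    (hB1 : ∀ (𝓑 : StationaryAFBlackHole.{0}) [𝓑.metric.HasLeviCivita],
      𝓑.metric.isOpen_chronologicalFuture 𝓑.timeOrientation →
      𝓑.metric.isOpen_chronologicalPast 𝓑.timeOrientation →
      𝓑.metric.IsGloballyHyperbolic 𝓑.timeOrientation →
      𝓑.metric.IsCauchyHypersurface 𝓑.timeOrientation (Set.range 𝓑.embed) →
      IsConnected 𝓑.horizon → 𝓑.toSpacetime.IsNonDegenerateHorizon 𝓑.Mext →
      Tendsto (fun x ↦ 𝓑.metric.val (𝓑.embed x) (𝓑.killing (𝓑.embed x))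
        (𝓑.killing (𝓑.embed x))) (⨅ R : ℝ, 𝓟 (𝓑.e.far R)) (𝓝 (-1)) →
      (∀ p ∈ 𝓑.horizon, 𝓑.metric.val p (𝓑.killing p) (𝓑.killing p) ≤ 0) →
      𝓑.metric.toPseudoRiemannianMetric.IsRicciFlat → 𝓑.IsIPlusRegular)
    (hB2 : ∀ (𝓑 : StationaryAFBlackHole.{0}) [𝓑.metric.HasLeviCivita],
      𝓑.metric.isOpen_chronologicalFuture 𝓑.timeOrientation →
      𝓑.metric.isOpen_chronologicalPast 𝓑.timeOrientation →
      𝓑.metric.IsGloballyHyperbolic 𝓑.timeOrientation →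
      𝓑.metric.IsCauchyHypersurface 𝓑.timeOrientation (Set.range 𝓑.embed) →
      IsConnected 𝓑.horizon → 𝓑.toSpacetime.IsNonDegenerateHorizon 𝓑.Mext →
      Tendsto (fun x ↦ 𝓑.metric.val (𝓑.embed x) (𝓑.killing (𝓑.embed x))
        (𝓑.killing (𝓑.embed x))) (⨅ R : ℝ, 𝓟 (𝓑.e.far R)) (𝓝 (-1)) →
      (∀ p ∈ 𝓑.horizon, 𝓑.metric.val p (𝓑.killing p) (𝓑.killing p) ≤ 0) →
      𝓑.metric.toPseudoRiemannianMetric.IsRicciFlat →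
      (∀ p ∈ 𝓑.horizon, 𝓑.killing p ≠ 0) ∧
        ∃ κ : ℝ, κ ≠ 0 ∧ ∀ p ∈ 𝓑.horizon,
          𝓑.metric.leviCivita 𝓑.killing p (𝓑.killing p) = κ • 𝓑.killing p) :
    Theses.SignedCensus.StaticAnchor := by
  intro 𝓑 _ _ hF hP hgh hcs hconn hnd hfar hlev hvac
  obtain ⟨hT, hκ⟩ := hB2 𝓑 hF hP hgh hcs hconn hnd hfar hlev hvac
  exact conclusion_of_isIPlusRegular_of_killing hSW hCG 𝓑 hF hP
    (hB1 𝓑 hF hP hgh hcs hconn hnd hfar hlev hvac) hvac hconn.nonempty hT hκ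

end Summit.FinalStateConjecture.FinalStateConjecture.Theorems.SignedCensus.StaticAnchor

end
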